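/- LEAD seat `ym-line-cbag-p1` (prover-ym-line-cbag-p1-g24-0), route `EguchiKawaiDirectionLadder` (ideator ym-idea-2, LINE 8),
crux K_A `TripleSmallBallMargin` (stmt-QuantumFields-27724), architecture note ARCH-27724-lead-g24 §2/§5 (S2+S4+S5 assembled):
the repaired within-cluster stub (a′) `FreeTripleSmallBallLe1` of the registered skeleton v6 (w5's `…TripleSmallBallMarginDefsV6`)
and the pair small-ball bound `PairSmallBall` are THEOREMS of the tree — entrywise rigidity on the circle (`entrywiseRigidity_holds`,
from w3's nested engine) fed into `pairSmallBall_of_entrywiseRigidity` and `freeTripleLe1_of_entrywiseRigidity` (Weyl's integral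
formula, proved in the tree, prices the first link).  `N`-uniform, unconditional, axioms standard.  This closes the (a)/(a′) half of
LINE 8's K_A; the crux itself (margin `e > 3/4` under centre symmetry) still needs the decoupling level (S6–S10).  Nothing here bears
on the Yang–Mills mass gap (barrier-ledger line onto `EguchiKawaiBreakdown`). -/
import Summits.QuantumFields.YangMills.Theorems.EguchiKawaiDirectionLadderTripleSmallBallMarginDefsV6
import Summits.QuantumFields.YangMills.Theorems.EguchiKawaiDirectionLadderEntrywiseRigidityCircle
import Summits.QuantumFields.YangMills.Theorems.EguchiKawaiDirectionLadderFreeTripleOfRigidity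
import HarnessLib

/-!
# Route `EguchiKawaiDirectionLadder`, crux `TripleSmallBallMargin`: (a′) `FreeTripleSmallBallLe1` and `PairSmallBall` hold

* `pairSmallBall_holds : PairSmallBall` — the `d = 2` Eguchi–Kawai small-ball bound: for every `η > 0` there are `C ≥ 0`, `N₀` with
  `ekHaar 2 N {S_R ≤ t} ≤ exp(N²(C − η log t)) · t^{C(N,2)}` for all `N ≥ N₀`, `0 < t ≤ 1`.
* `freeTripleSmallBallLe1_holds : FreeTripleSmallBallLe1` — the `d = 3` Bhanot–Heller–Neuberger bound: for every `η > 0` there are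
  `C ≥ 0`, `N₀` with `ekHaar 3 N {S_R ≤ t} ≤ exp(N²((3/4 − η) log t + C))` for all `N ≥ N₀`, `0 < t ≤ 1` (the exponent `3/4` is sharp:
  `Literature.Barriers.QuantumFields.ekHaar_action_le_ge`).

Both by `entrywiseRigidity_holds` (S2) ∘ the reductions of `…PairSmallBall` (S4) and `…FreeTripleOfRigidity` (S5).
-/

set_option autoImplicit false

namespace Summit.QuantumFields.YangMills.Theorems.EguchiKawaiDirectionLadder

/-- **The pair small-ball bound holds** (`d = 2` Eguchi–Kawai small ball, one factor `t` per unordered eigenvalue pair, `N`-uniform). -/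
theorem pairSmallBall_holds : PairSmallBall :=
  pairSmallBall_of_entrywiseRigidity entrywiseRigidity_holds

/-- **(a′) holds**: the free triple small-ball bound `FreeTripleSmallBallLe1` of skeleton v6 of stmt-QuantumFields-27724 — the
`N`-uniform Bhanot–Heller–Neuberger exponent `3/4 − η` for Haar triples at reduced-action precision `0 < t ≤ 1`. -/
theorem freeTripleSmallBallLe1_holds : FreeTripleSmallBallLe1 :=
  freeTripleLe1_of_entrywiseRigidity entrywiseRigidity_holds

end Summit.QuantumFields.YangMills.Theorems.EguchiKawaiDirectionLadder
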